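import Mathlib
import Summits.HodgeConjecture.FermatCycles.HodgeFermatNuChar

/-!
# THEOREM (ν odd) at prime levels and THEOREM (Σν) at every prime (`HodgeFermat/NuOdd.lean`)

Tree copy (whole module) of the module `HodgeFermat/NuOdd.lean` of the sibling cell's standalone package
`run/shared/lean/pub/pub-hodgefermat/lean/HodgeFermat/` (274 lines, sha256 `c132f78d1e7e20e8…`), source lines 21–274 (all).
Filed by cell `pub-hfermat`, seat prover-1 gen-0, on the COORDINATOR KEEPER RULING of 2026-08-25 (gem sweep H1: take the
off-gate kernel theorem `thmFstar` — `HodgeFermat/DecodingFinal.lean:29` — through the gate); this file is one link of the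
minimal import closure of `thmFstar`.  The source module's declarations are VERBATIM those of the cell record
`check/DecodingFinal_standalone.lean` (27 bodies, 454 223 B, sha256 dca6f17de93119a6…, hub `lean check` rc 0, 130.1 s; pub-hodgefermat `CERT.md` l.978, GATE HF-G32).
Deviations from the source module, exhaustively: the `import` lines (tree modules `Summits.HodgeConjecture.FermatCycles.
HodgeFermat*` instead of `HodgeFermat.*`); this module docstring; one-line docstrings added (gate lint) to `nuEntry_eq_zero`, `even_inv`.
Every other line — in particular every declaration's statement and proof — is byte-identical to the source.
HONEST FRAMING: explicit algebraic cycles for specific Hodge classes on Fermat/Delsarte varieties; residual open instances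
listed; no claim on general Hodge.  (This file is arithmetic of CM types; it claims nothing about cycles.)

The source module's docstring (NuOdd.lean l.1–18), verbatim:

Copyright: pub-hodgefermat, generation 31 (fifth target, HF-G31e).  KR-free.
## NuOdd — THEOREM (ν odd) of `tables/DPRIME-THEOREM.md` §7.1 at prime levels, and THEOREM (Σν) at EVERY prime
  p ≥ 17 (including p ≡ 1 (mod 3)), from LEMMA E at χ₃ × ψ (`NuChar.lemmaE_nu3`) by Fourier inversion on (ℤ/p)ˣ
  and a support count.  Light module (hypothesis `H0`); `NuOddFinal` discharges `H0` with `HurwitzZero.hypH0`.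

For a triple `T = (a, b, c)` let `ν_T : ℤ/p → ℤ`, `ν_T(x) = Σ_{a ∈ T, 3 ∤ a, a ≡ x (p)} χ₃(a)` (`nuEntry`, `nuFun`).
Then `Σ_x ν_T(x) ψ⁻¹(x) = Σ_{a ∈ T} nu3 ψ a` (`hat_nuFun`), so by `lemmaE_nu3` every coefficient of
`D = ν_T − ν_T′` at an EVEN NON-TRIVIAL character vanishes (`hat_diff_eq_zero`).  Character orthogonality then gives
`φ(p)·(D(u) + D(−u)) = 2δ` for every unit `u`, `δ = Σ_{units} D` (`totient_mul_add_neg`); since `D` is supported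
on the six residues of the entries, at a prime `p ≥ 17` some unit `u` has `D(u) = D(−u) = 0`, whence `δ = 0`:
* `nu_odd`     : `D(−x) = −D(x)` on `ℤ/p` — "ν odd" (DPRIME §7.1, second half, prime levels p ≥ 17);
* `nu_sum_eq`  : `χ₃(a) + χ₃(b) + χ₃(c) = χ₃(a′) + χ₃(b′) + χ₃(c′)` — THEOREM (Σν) (`ChiThree.nu_eq_of_sameType`)
  now at EVERY prime level p ≥ 17 for entries prime to p, also when p ≡ 1 (mod 3) where the elementary congruence
  method of `ChiThree` does not apply (and where it is false for p = 7, 13: control of HF-G31d).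
Record: `check/NuOdd_standalone.lean` (7 bodies: LemmaN, ChiThree, TwistedMoment, LemmaEMu, LemmaENu, NuChar, NuOdd).
Cross-read: `results/gen31/local/nu_odd_scan_131.txt`; planted controls `code/gen31/lean-controls-g31e/`.
-/

namespace HodgeFermat.KRFree.NuOdd

open Finset HodgeFermat.KRFree.LemmaN HodgeFermat.KRFree.TwistedMoment HodgeFermat.KRFree.LemmaEMu
open HodgeFermat.KRFree.ChiThree (chi3 chi3_of_dvd)
open HodgeFermat.KRFree.NuChar (nu3 lemmaE_nu3)

variable {p : ℕ}

/-- the ν-weight of one entry `a` as an integer function on `ℤ/p`: `χ₃(a)·[a ≡ x]` if `3 ∤ a`, `0` if `3 ∣ a` -/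
def nuEntry (a : ℕ) (x : ZMod p) : ℤ :=
  if 3 ∣ a then 0 else (if ((a : ℕ) : ZMod p) = x then chi3 a else 0)

/-- `ν_T(x)` of DPRIME §7.1 for a triple `T` -/
def nuFun (T : ℕ × ℕ × ℕ) (x : ZMod p) : ℤ := nuEntry T.1 x + nuEntry T.2.1 x + nuEntry T.2.2 x

/-- `nuEntry a x = 0` unless `x` is the residue of `a` -/
lemma nuEntry_eq_zero {a : ℕ} {x : ZMod p} (h : ((a : ℕ) : ZMod p) ≠ x) : nuEntry a x = 0 := by
  unfold nuEntry
  rw [if_neg h]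
  split_ifs <;> rfl

section transform

variable [NeZero p]

/-- `Σ_x ν_a(x)·ψ⁻¹(x) = nu3 ψ a` for one entry -/
lemma hat_nuEntry (ψ : DirichletCharacter ℂ p) (a : ℕ) :
    ∑ x : ZMod p, (nuEntry a x : ℂ) * ψ⁻¹ x = nu3 ψ a := by
  unfold nuEntry nu3
  by_cases h3 : 3 ∣ a
  · simp [h3]
  · simp only [h3, if_false]
    push_cast
    simp only [ite_mul, zero_mul, Finset.sum_ite_eq, Finset.mem_univ, if_true]

/-- `Σ_x ν_T(x)·ψ⁻¹(x) = Σ_{a ∈ T} nu3 ψ a` -/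
lemma hat_nuFun (ψ : DirichletCharacter ℂ p) (a b c : ℕ) :
    ∑ x : ZMod p, (nuFun (a, b, c) x : ℂ) * ψ⁻¹ x = nu3 ψ a + nu3 ψ b + nu3 ψ c := by
  simp only [nuFun, Int.cast_add, add_mul, Finset.sum_add_distrib, hat_nuEntry]

/-- LEMMA E (ν-part) in transform form: the coefficients of `ν_T − ν_T′` at even non-trivial characters vanish
(from H0). -/
theorem hat_diff_eq_zero (h0 : H0) (hp : p.Prime) (hp3 : p ≠ 3) (ψ : DirichletCharacter ℂ p) (hψ : ψ.Even)
    (hψ1 : ψ ≠ 1) {a b c a' b' c' : ℕ} (hs : 3 * p ∣ a + b + c) (hs' : 3 * p ∣ a' + b' + c')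
    (ha : Nat.Coprime a p) (hb : Nat.Coprime b p) (hc : Nat.Coprime c p)
    (ha' : Nat.Coprime a' p) (hb' : Nat.Coprime b' p) (hc' : Nat.Coprime c' p)
    (hT : SameType (3 * p) (a, b, c) (a', b', c')) :
    ∑ x : ZMod p, ((nuFun (a, b, c) x - nuFun (a', b', c') x : ℤ) : ℂ) * ψ⁻¹ x = 0 := by
  have h := lemmaE_nu3 h0 hp hp3 ψ hψ hψ1 hs hs' ha hb hc ha' hb' hc' hT
  simp only [Int.cast_sub, sub_mul, Finset.sum_sub_distrib, hat_nuFun, h, sub_self]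

omit [NeZero p] in
/-- the inverse of an even character is even -/
lemma even_inv {χ : DirichletCharacter ℂ p} (hχ : χ.Even) : (χ⁻¹).Even := by
  unfold DirichletCharacter.Even at *
  rw [MulChar.inv_apply_eq_inv', hχ, inv_one]

/-- the total mass on the units: `Σ_x ν_a(x)·𝟙(x) = χ₃(a)` for `a` prime to `p` -/
lemma sum_nuEntry_one {a : ℕ} (ha : Nat.Coprime a p) :
    ∑ x : ZMod p, (nuEntry a x : ℂ) * (1 : DirichletCharacter ℂ p) x = (chi3 a : ℂ) := by
  have h := hat_nuEntry (1 : DirichletCharacter ℂ p) a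
  rw [inv_one] at h
  rw [h]
  unfold nu3
  by_cases h3 : 3 ∣ a
  · rw [if_pos h3, chi3_of_dvd h3]; simp
  · rw [if_neg h3, inv_one, MulChar.one_apply ((ZMod.isUnit_iff_coprime a p).mpr ha), mul_one]

/-- Fourier inversion on `(ℤ/p)ˣ`: if all coefficients of `F` at EVEN NON-TRIVIAL characters vanish, then
`φ(p)·(F(u) + F(−u)) = 2·Σ_x F(x)𝟙(x)` for every unit `u`. -/
theorem totient_mul_add_neg (F : ZMod p → ℂ)
    (hF : ∀ ψ : DirichletCharacter ℂ p, ψ.Even → ψ ≠ 1 → ∑ x : ZMod p, F x * ψ⁻¹ x = 0) (u : (ZMod p)ˣ) :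
    (p.totient : ℂ) * (F u + F (-(u : ZMod p))) = 2 * ∑ x : ZMod p, F x * (1 : DirichletCharacter ℂ p) x := by
  -- the coefficients of `G(x) = F(x) + F(−x)`
  have hG : ∀ χ : DirichletCharacter ℂ p,
      ∑ x : ZMod p, (F x + F (-x)) * χ x = (1 + χ (-1)) * ∑ x : ZMod p, F x * χ x := by
    intro χ
    have hneg : ∑ x : ZMod p, F (-x) * χ x = χ (-1) * ∑ x : ZMod p, F x * χ x := by
      rw [show ∑ x : ZMod p, F (-x) * χ x = ∑ x : ZMod p, F x * χ (-x) from
        Fintype.sum_equiv (Equiv.neg (ZMod p)) _ _ (fun x => by simp), Finset.mul_sum]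
      refine Finset.sum_congr rfl (fun x _ => ?_)
      rw [neg_eq_neg_one_mul x, map_mul]
      ring
    rw [Finset.sum_congr rfl (fun x _ => add_mul (F x) (F (-x)) (χ x)), Finset.sum_add_distrib, hneg]
    ring
  have hG' : ∀ χ : DirichletCharacter ℂ p, χ ≠ 1 → ∑ x : ZMod p, (F x + F (-x)) * χ x = 0 := by
    intro χ hχ1
    rw [hG χ]
    rcases χ.even_or_odd with he | ho
    · have hne : χ⁻¹ ≠ 1 := by rwa [Ne, inv_eq_one]
      have h1 := hF χ⁻¹ (even_inv he) hne
      rw [inv_inv] at h1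
      rw [h1, mul_zero]
    · rw [ho]; ring
  have h1m : (1 : DirichletCharacter ℂ p) (-1) = 1 := MulChar.one_apply isUnit_one.neg
  have hG1 : ∑ x : ZMod p, (F x + F (-x)) * (1 : DirichletCharacter ℂ p) x
      = 2 * ∑ x : ZMod p, F x * (1 : DirichletCharacter ℂ p) x := by
    rw [hG 1, h1m]
    norm_num
  -- inversion at the unit `u`
  have hu : IsUnit (u : ZMod p) := Units.isUnit u
  have hinv : ∑ χ : DirichletCharacter ℂ p, χ ((u : ZMod p)⁻¹) * ∑ x : ZMod p, (F x + F (-x)) * χ x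
      = (p.totient : ℂ) * (F u + F (-(u : ZMod p))) := by
    calc ∑ χ : DirichletCharacter ℂ p, χ ((u : ZMod p)⁻¹) * ∑ x : ZMod p, (F x + F (-x)) * χ x
        = ∑ χ : DirichletCharacter ℂ p, ∑ x : ZMod p, (F x + F (-x)) * (χ ((u : ZMod p)⁻¹) * χ x) := by
            refine Finset.sum_congr rfl (fun χ _ => ?_)
            rw [Finset.mul_sum]
            exact Finset.sum_congr rfl (fun x _ => by ring)
      _ = ∑ x : ZMod p, (F x + F (-x)) * ∑ χ : DirichletCharacter ℂ p, χ ((u : ZMod p)⁻¹) * χ x := by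
            rw [Finset.sum_comm]
            exact Finset.sum_congr rfl (fun x _ => by rw [Finset.mul_sum])
      _ = ∑ x : ZMod p, (F x + F (-x)) * (if (u : ZMod p) = x then (p.totient : ℂ) else 0) := by
            refine Finset.sum_congr rfl (fun x _ => ?_)
            rw [DirichletCharacter.sum_char_inv_mul_char_eq ℂ hu x]
      _ = (p.totient : ℂ) * (F u + F (-(u : ZMod p))) := by
            simp only [mul_ite, mul_zero]
            rw [Finset.sum_ite_eq]
            simp [mul_comm]
  have hsingle : ∑ χ : DirichletCharacter ℂ p, χ ((u : ZMod p)⁻¹) * ∑ x : ZMod p, (F x + F (-x)) * χ x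
      = 2 * ∑ x : ZMod p, F x * (1 : DirichletCharacter ℂ p) x := by
    rw [Finset.sum_eq_single (1 : DirichletCharacter ℂ p)]
    · rw [hG1, ZMod.inv_coe_unit, MulChar.one_apply_coe, one_mul]
    · intro χ _ hχ1
      rw [hG' χ hχ1, mul_zero]
    · intro h
      exact absurd (Finset.mem_univ _) h
  rw [← hinv, hsingle]

end transform

section count

/-- at a prime `p ≥ 17`, outside any twelve residues and `0` there is still a residue -/
lemma exists_avoid [NeZero p] (hp14 : 14 ≤ p) (M : Finset (ZMod p)) (hM : M.card ≤ 12) :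
    ∃ x : ZMod p, x ≠ 0 ∧ x ∉ M := by
  have hcard : (insert (0 : ZMod p) M).card < (Finset.univ : Finset (ZMod p)).card := by
    rw [Finset.card_univ, ZMod.card]
    calc (insert (0 : ZMod p) M).card ≤ M.card + 1 := Finset.card_insert_le 0 M
      _ < p := by omega
  obtain ⟨x, -, hx⟩ := Finset.exists_mem_notMem_of_card_lt_card hcard
  simp only [Finset.mem_insert, not_or] at hx
  exact ⟨x, hx.1, hx.2⟩

/-- `ν_T − ν_T′` vanishes off the six residues of the entries -/
lemma diff_eq_zero_of_notMem {a b c a' b' c' : ℕ} {x : ZMod p}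
    (hx : x ∉ ([((a : ℕ) : ZMod p), ((b : ℕ) : ZMod p), ((c : ℕ) : ZMod p), ((a' : ℕ) : ZMod p),
      ((b' : ℕ) : ZMod p), ((c' : ℕ) : ZMod p)] : List (ZMod p)).toFinset) :
    nuFun (a, b, c) x - nuFun (a', b', c') x = 0 := by
  simp only [List.mem_toFinset, List.mem_cons, List.not_mem_nil, or_false, not_or] at hx
  obtain ⟨h1, h2, h3, h4, h5, h6⟩ := hx
  simp only [nuFun]
  rw [nuEntry_eq_zero (Ne.symm h1), nuEntry_eq_zero (Ne.symm h2), nuEntry_eq_zero (Ne.symm h3),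
    nuEntry_eq_zero (Ne.symm h4), nuEntry_eq_zero (Ne.symm h5), nuEntry_eq_zero (Ne.symm h6)]
  simp

end count

/-- **THE KEY STEP (from H0).**  For a prime `p ≥ 17` and two zero-sum same-type triples mod `3p` with entries prime
to `p`: (i) the total `δ = (χ₃(a) + χ₃(b) + χ₃(c)) − (χ₃(a′) + χ₃(b′) + χ₃(c′))` vanishes and (ii) `D(u) + D(−u) = 0`
for every unit `u`, where `D = ν_T − ν_T′`. -/
theorem key (h0 : H0) (hp : p.Prime) (hp17 : 17 ≤ p)
    {a b c a' b' c' : ℕ} (hs : 3 * p ∣ a + b + c) (hs' : 3 * p ∣ a' + b' + c')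
    (ha : Nat.Coprime a p) (hb : Nat.Coprime b p) (hc : Nat.Coprime c p)
    (ha' : Nat.Coprime a' p) (hb' : Nat.Coprime b' p) (hc' : Nat.Coprime c' p)
    (hT : SameType (3 * p) (a, b, c) (a', b', c')) :
    ((chi3 a + chi3 b + chi3 c : ℤ) : ℂ) = ((chi3 a' + chi3 b' + chi3 c' : ℤ) : ℂ) ∧
    ∀ u : (ZMod p)ˣ, ((nuFun (a, b, c) (u : ZMod p) - nuFun (a', b', c') (u : ZMod p) : ℤ) : ℂ)
      + ((nuFun (a, b, c) (-(u : ZMod p)) - nuFun (a', b', c') (-(u : ZMod p)) : ℤ) : ℂ) = 0 := by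
  haveI : NeZero p := ⟨hp.ne_zero⟩
  haveI : Fact p.Prime := ⟨hp⟩
  have hp3 : p ≠ 3 := by omega
  set F : ZMod p → ℂ := fun y => ((nuFun (a, b, c) y - nuFun (a', b', c') y : ℤ) : ℂ) with hFdef
  have hF : ∀ ψ : DirichletCharacter ℂ p, ψ.Even → ψ ≠ 1 → ∑ x : ZMod p, F x * ψ⁻¹ x = 0 :=
    fun ψ hψ hψ1 => hat_diff_eq_zero h0 hp hp3 ψ hψ hψ1 hs hs' ha hb hc ha' hb' hc' hT
  have inv := totient_mul_add_neg F hF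
  -- the total mass δ
  have hδ : ∑ x : ZMod p, F x * (1 : DirichletCharacter ℂ p) x
      = ((chi3 a + chi3 b + chi3 c : ℤ) : ℂ) - ((chi3 a' + chi3 b' + chi3 c' : ℤ) : ℂ) := by
    simp only [hFdef, nuFun, Int.cast_sub, Int.cast_add, sub_mul, add_mul, Finset.sum_sub_distrib,
      Finset.sum_add_distrib, sum_nuEntry_one ha, sum_nuEntry_one hb, sum_nuEntry_one hc, sum_nuEntry_one ha',
      sum_nuEntry_one hb', sum_nuEntry_one hc']
  -- a unit outside the twelve residues ±(entries)
  set l : List (ZMod p) := [((a : ℕ) : ZMod p), ((b : ℕ) : ZMod p), ((c : ℕ) : ZMod p), ((a' : ℕ) : ZMod p),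
      ((b' : ℕ) : ZMod p), ((c' : ℕ) : ZMod p)] with hl
  set L : Finset (ZMod p) := l.toFinset with hL
  set M : Finset (ZMod p) := L ∪ L.image (fun y => -y) with hM
  have hLc : L.card ≤ 6 := by
    have h1 : L.card ≤ l.length := List.toFinset_card_le l
    have h2 : l.length = 6 := by simp [hl]
    omega
  have hMc : M.card ≤ 12 := by
    have h1 : M.card ≤ L.card + (L.image (fun y => -y)).card := Finset.card_union_le _ _
    have h2 : (L.image (fun y => -y)).card ≤ L.card := Finset.card_image_le
    omega
  obtain ⟨x, hx0, hxM⟩ := exists_avoid (by omega) M hMc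
  have hxL : x ∉ L := fun h => hxM (Finset.mem_union_left _ h)
  have hnxL : -x ∉ L := fun h => hxM (Finset.mem_union_right _ (Finset.mem_image.mpr ⟨-x, h, neg_neg x⟩))
  have hFx : F x = 0 := by
    have h := diff_eq_zero_of_notMem hxL
    simp only [hFdef, h, Int.cast_zero]
  have hFnx : F (-x) = 0 := by
    have h := diff_eq_zero_of_notMem hnxL
    simp only [hFdef, h, Int.cast_zero]
  obtain ⟨u, rfl⟩ := isUnit_iff_ne_zero.mpr hx0
  have h2δ : 2 * ∑ x : ZMod p, F x * (1 : DirichletCharacter ℂ p) x = 0 := by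
    rw [← inv u, hFx, hFnx, add_zero, mul_zero]
  have hδ0 : ((chi3 a + chi3 b + chi3 c : ℤ) : ℂ) - ((chi3 a' + chi3 b' + chi3 c' : ℤ) : ℂ) = 0 := by
    rw [← hδ]
    have := h2δ
    simpa using this
  refine ⟨sub_eq_zero.mp hδ0, fun v => ?_⟩
  have hφ : (p.totient : ℂ) ≠ 0 := Nat.cast_ne_zero.mpr (Nat.totient_pos.mpr (NeZero.pos p)).ne'
  have hv := inv v
  rw [h2δ] at hv
  exact (mul_eq_zero.mp hv).resolve_left hφ

/-- **THEOREM (Σν at every prime p ≥ 17; from H0).**  For a prime `p ≥ 17` and two zero-sum triples mod `3p` with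
entries prime to `p` and the same CM type, `χ₃(a) + χ₃(b) + χ₃(c) = χ₃(a′) + χ₃(b′) + χ₃(c′)` — also for
`p ≡ 1 (mod 3)`. -/
theorem nu_sum_eq (h0 : H0) (hp : p.Prime) (hp17 : 17 ≤ p)
    {a b c a' b' c' : ℕ} (hs : 3 * p ∣ a + b + c) (hs' : 3 * p ∣ a' + b' + c')
    (ha : Nat.Coprime a p) (hb : Nat.Coprime b p) (hc : Nat.Coprime c p)
    (ha' : Nat.Coprime a' p) (hb' : Nat.Coprime b' p) (hc' : Nat.Coprime c' p)
    (hT : SameType (3 * p) (a, b, c) (a', b', c')) :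
    chi3 a + chi3 b + chi3 c = chi3 a' + chi3 b' + chi3 c' := by
  have h := (key h0 hp hp17 hs hs' ha hb hc ha' hb' hc' hT).1
  exact_mod_cast h

/-- **THEOREM (ν odd; from H0).**  For a prime `p ≥ 17` and two zero-sum triples mod `3p` with entries prime to `p`
and the same CM type, the integer function `ν_T − ν_T′` on `ℤ/p` is ODD: `D(−x) = −D(x)`.  (Character-free; DPRIME
§7.1, second half, at prime levels.) -/
theorem nu_odd (h0 : H0) (hp : p.Prime) (hp17 : 17 ≤ p)
    {a b c a' b' c' : ℕ} (hs : 3 * p ∣ a + b + c) (hs' : 3 * p ∣ a' + b' + c')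
    (ha : Nat.Coprime a p) (hb : Nat.Coprime b p) (hc : Nat.Coprime c p)
    (ha' : Nat.Coprime a' p) (hb' : Nat.Coprime b' p) (hc' : Nat.Coprime c' p)
    (hT : SameType (3 * p) (a, b, c) (a', b', c')) (x : ZMod p) :
    nuFun (a, b, c) (-x) - nuFun (a', b', c') (-x) = -(nuFun (a, b, c) x - nuFun (a', b', c') x) := by
  haveI : NeZero p := ⟨hp.ne_zero⟩
  haveI : Fact p.Prime := ⟨hp⟩
  by_cases hx : x = 0
  · subst hx
    have ne : ∀ {y : ℕ}, Nat.Coprime y p → ((y : ℕ) : ZMod p) ≠ 0 := by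
      intro y hy h
      rw [ZMod.natCast_eq_zero_iff] at h
      exact hp.one_lt.ne' (Nat.Coprime.eq_one_of_dvd (Nat.coprime_comm.mp hy) h)
    have hz : ∀ {y : ℕ}, Nat.Coprime y p → nuEntry y (0 : ZMod p) = 0 := fun hy => nuEntry_eq_zero (ne hy)
    simp only [neg_zero, nuFun, hz ha, hz hb, hz hc, hz ha', hz hb', hz hc']
    simp
  · obtain ⟨u, rfl⟩ := isUnit_iff_ne_zero.mpr hx
    have h := (key h0 hp hp17 hs hs' ha hb hc ha' hb' hc' hT).2 u
    have h' : ((nuFun (a, b, c) (-(u : ZMod p)) - nuFun (a', b', c') (-(u : ZMod p)) : ℤ) : ℂ)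
        = -(((nuFun (a, b, c) (u : ZMod p) - nuFun (a', b', c') (u : ZMod p) : ℤ) : ℂ)) := by
      linear_combination h
    exact_mod_cast h'

end HodgeFermat.KRFree.NuOdd
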